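import Literature.AlgebraicGeometry.AbelianSchemes.AbelianSchemeTheoremOfCubeLocallyNoetherian
import Literature.AlgebraicGeometry.AbelianSchemes.RigidifiedTrivialFpqcDescent
import Literature.AlgebraicGeometry.AbelianSchemes.ModuleSliceOfBaseChange
import Literature.AlgebraicGeometry.Modules.DetClassOfIso
import Mathlib.AlgebraicGeometry.Morphisms.Flat
import Mathlib.AlgebraicGeometry.Morphisms.Affine
import Mathlib.AlgebraicGeometry.PullbackCarrier
import HarnessLib

/-!
# The theorem of the square for the Poincaré family `𝒫` on `A × Â`, `Â = A/K(L)`, in the `Â`-variable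
# (Mumford, *Abelian Varieties* §13 with §6 Cor. 4 and §8; relative, over a locally Noetherian base)

Layer `Literature/AlgebraicGeometry/AbelianSchemes`, namespace `Literature.AlgebraicGeometry.AbelianSchemes.AbelianSchemeOver`.
THEOREMS ONLY (no definition, no named fact, no instance, no `sorry`).

Setting ([MumfordAV1970] §13 p. 125; [MumfordFogartyKirwan1994] Ch. 6 §2): `A → S` an abelian scheme over a LOCALLY NOETHERIAN base, `L`
of rank one on `A` rigidified along the zero section (`ε^*[L] = 1`), `Â → S` an abelian scheme with a FINITE (affine) FLAT SURJECTIVE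
homomorphism `π : A → Â`, and `𝒫` of rank one on `A ×_S Â` with `(1 × π)^*𝒫 ≅ Λ(L)` (★ `mumfordBundle`) and `(ε × 1)^*𝒫 ≅ 𝒪` (★ `unitSlice`).

* **`cechPic_pullback_whiskerLeft_mul_poincareClass`** — for every `T : Over S` and `y₁ y₂ : T ⟶ Â` over `S`:
  `[(1 × (y₁·y₂))^*𝒫] = [(1 × y₁)^*𝒫] · [(1 × y₂)^*𝒫]` in `Pic(A ×_S T)` (Čech classes ★ `CechPic`), i.e. `y ↦ [(1 × y)^*𝒫]` is a
  homomorphism `Â(T) → Pic(A_T)` — the theorem of the square ([MumfordAV1970] §6 Cor. 4) for the family `𝒫` in the `Â`-variable.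
  PROOF (the étale-cover trick): on the affine flat surjective cover `r : T″ := (T ×_{y₁,Â} A) ×_T (T ×_{y₂,Â} A) → T` both points lift
  tautologically through `π` (`aᵢ ≫ π = r ≫ yᵢ`), so `(1 × r)^*` of both sides are `[(1 × (a₁·a₂))^*Λ(L)]` resp. `[(1 × a₁)^*Λ(L)]·[(1 × a₂)^*Λ(L)]`,
  equal by the ★ theorem of the square for `Λ(L)` (`cechPic_pullback_whiskerLeft_mul_mumfordClass_of_isLocallyNoetherian`); both sides are
  classes of line bundles RIGIDIFIED along `ε × T` (`(ε × 1)^*𝒫 ≅ 𝒪`), and rigidified line bundles isomorphic after the affine faithfully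
  flat base change `T″ → T` are isomorphic (★ `RigidifiedLineBundle.nonempty_iso_of_pullback_prodMap_of_isLocallyNoetherian`, fpqc descent).
* `unitSlice_eq_lift_left'`, `unitSection_baseChange_comp_whiskerLeft_left_eq_comp_unitSlice`, `cechPic_pullback_unitSection_whiskerLeft_poincareClass` — the
  rigidification of `(1 × y)^*𝒫` along `ε × T` («`ε_T ≫ (1 × y) = y ≫ (ε × 1)`»).

This is brick (Q1) of node S-e (Kodaira–Spencer surjectivity) of the cell's (Mc) N3′ tower (F-3 child line
`Cruxes/HDel/Lines/F3DualAbelianSchemeM`, stub (Mc)); B-p07 (g20).  HC_CM is proved only modulo the 7 printed citations until rung 0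
closes; nothing here is about HC.

## References
* [MumfordAV1970] D. Mumford, *Abelian Varieties* (1970), §6 Cor. 4 (p. 59), §8 (pp. 74–81), §13 (pp. 125–130).
* [MumfordFogartyKirwan1994] D. Mumford, J. Fogarty, F. Kirwan, *GIT*, 3rd ed. (1994), Ch. 6 §2 Def. 6.2 (p. 120), p. 121.
* [MilneAV2008] J. S. Milne, *Abelian Varieties* (2008), I §8 (pp. 36–37).
* [StacksProject] The Stacks project, Tag 02VW, Tag 023Q.
-/

set_option autoImplicit false

noncomputable section

-- `TopCat.Presheaf`/`Scheme.Modules` are not reducible (as in ★ `AbelianSchemeKOfL`).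
set_option backward.isDefEq.respectTransparency false

open CategoryTheory CategoryTheory.Limits AlgebraicGeometry MonoidalCategory CartesianMonoidalCategory
open scoped MonObj

namespace Literature.AlgebraicGeometry.AbelianSchemes

open Literature.AlgebraicGeometry.Motives Literature.AlgebraicGeometry.Modules Literature.AlgebraicGeometry.AbelianVarieties

namespace AbelianSchemeOver

/-! ## §1 The slice `ε × 1` and the zero section of `A_T` -/

section Slice

variable {S : Scheme.{0}} (A hat : AbelianSchemeOver S)

/-- `ε × 1_Â = (1, 𝟙) : Â → A ×_S Â` as the underlying morphism of the cartesian pairing in `Over S` (★ `unitSlice_eq_lift_left` for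
`Â = A`). [cite: MumfordFogartyKirwan1994, Ch. 6 §2 (p. 121)] -/
theorem unitSlice_eq_lift_left' : A.unitSlice hat = (lift (1 : hat.X ⟶ A.X) (𝟙 hat.X)).left := by
  apply pullback.hom_ext
  · rw [A.unitSlice_fst, ← Over.fst_left, ← Over.comp_left, lift_fst, Hom.one_def, Over.comp_left, Over.toUnit_left]
  · rw [A.unitSlice_snd, ← Over.snd_left, ← Over.comp_left, lift_snd, Over.id_left]

/-- **`ε_T ≫ (1_A × y) = y ≫ (ε × 1_Â)`**: the zero section of `A_T` followed by `1 × y` is the slice `ε × 1` at the point `y`.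
[cite: MumfordFogartyKirwan1994, Ch. 6 §2 (p. 121)] [cite: GortzWedhorn2020, Section (4.7) (pp. 107–108)] -/
theorem unitSection_baseChange_comp_whiskerLeft_left_eq_comp_unitSlice {T : Over S} (y : T ⟶ hat.X) :
    ((A.baseChange T.hom).unitSection : T.left ⟶ (A.X ⊗ T).left) ≫ (A.X ◁ y).left = y.left ≫ A.unitSlice hat := by
  rw [A.unitSection_baseChange_eq_lift_left, A.unitSlice_eq_lift_left' hat, ← Over.comp_left, ← Over.comp_left, lift_whiskerLeft,
    comp_lift, MonObj.comp_one, Category.id_comp, Category.comp_id]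

variable (P : (A.prodLeft hat).Modules) (h1 : HasRank P 1)
  (hrig : Nonempty ((Scheme.Modules.pullback (A.unitSlice hat)).obj P ≅ SheafOfModules.unit _))

include hrig in
/-- `(ε × 1)^*[𝒫] = 1`. [cite: MumfordFogartyKirwan1994, Ch. 6 §2 (p. 121)] -/
theorem cechPic_pullback_unitSlice_poincareClass :
    CechPic.pullback (A.unitSlice hat) (detClass (HasRank.isFiniteLocallyFree' h1)) = 1 := by
  obtain ⟨eρ⟩ := hrig
  rw [← detClass_pullback (A.unitSlice hat) (HasRank.isFiniteLocallyFree' h1),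
    detClass_eq_of_iso eρ _ (HasRank.isFiniteLocallyFree' hasRank_unitModule), detClass_unitModule_eq_one]

include hrig in
/-- **`(1 × y)^*𝒫` is rigidified along `ε_T`**: `ε_T^*[(1 × y)^*𝒫] = y^*((ε × 1)^*[𝒫]) = 1`.
[cite: MumfordFogartyKirwan1994, Ch. 6 §2 (p. 121)] [cite: MilneAV2008, I §8 (pp. 36–37)] -/
theorem cechPic_pullback_unitSection_whiskerLeft_poincareClass {T : Over S} (y : T ⟶ hat.X) :
    CechPic.pullback ((A.baseChange T.hom).unitSection : T.left ⟶ (A.X ⊗ T).left)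
      (CechPic.pullback (A.X ◁ y).left (detClass (HasRank.isFiniteLocallyFree' h1))) = 1 := by
  calc CechPic.pullback ((A.baseChange T.hom).unitSection : T.left ⟶ (A.X ⊗ T).left)
        (CechPic.pullback (A.X ◁ y).left (detClass (HasRank.isFiniteLocallyFree' h1)))
      = CechPic.pullback (((A.baseChange T.hom).unitSection : T.left ⟶ (A.X ⊗ T).left) ≫ (A.X ◁ y).left)
          (detClass (HasRank.isFiniteLocallyFree' h1)) := by rw [CechPic.pullback_comp]; rfl
    _ = CechPic.pullback (y.left ≫ A.unitSlice hat) (detClass (HasRank.isFiniteLocallyFree' h1)) := by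
          rw [A.unitSection_baseChange_comp_whiskerLeft_left_eq_comp_unitSlice hat y]; rfl
    _ = 1 := by rw [CechPic.pullback_comp, A.cechPic_pullback_unitSlice_poincareClass hat P h1 hrig, map_one]

end Slice

/-! ## §2 The theorem of the square for `𝒫` in the `Â`-variable -/

section Square

variable {S : Scheme.{0}} [IsLocallyNoetherian S] (A hat : AbelianSchemeOver S) (π : A.X ⟶ hat.X) [IsMonHom π]
  [IsAffineHom π.left] [Flat π.left] [Surjective π.left]
  {L : A.left.Modules} (hL : HasRank L 1)
  (hε : CechPic.pullback A.unitSection (detClass (HasRank.isFiniteLocallyFree' hL)) = 1)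
  (P : (A.prodLeft hat).Modules) (h1 : HasRank P 1)
  (hrig : Nonempty ((Scheme.Modules.pullback (A.unitSlice hat)).obj P ≅ SheafOfModules.unit _))
  (hsock : Nonempty ((Scheme.Modules.pullback (A.X ◁ π).left).obj P ≅ A.mumfordBundle L))

include hε hrig hsock in
/-- **THE THEOREM OF THE SQUARE FOR `𝒫` IN THE `Â`-VARIABLE**: `[(1 × (y₁·y₂))^*𝒫] = [(1 × y₁)^*𝒫]·[(1 × y₂)^*𝒫]` in `Pic(A ×_S T)` for all
`T`-points `y₁, y₂` of `Â` over `S` ([MumfordAV1970] §6 Cor. 4, §8, §13: `𝒫|_{A × {y}}` is additive in `y`).  Proof: étale-cover trick +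
★ square for `Λ(L)` + fpqc descent of rigidified line bundles (module docstring). [cite: MumfordAV1970, §6 Cor. 4 (p. 59), §13 (pp. 125–130)]
[cite: MilneAV2008, I §8 (pp. 36–37)] [cite: StacksProject, Tag 023Q] -/
theorem cechPic_pullback_whiskerLeft_mul_poincareClass {T : Over S} (y₁ y₂ : T ⟶ hat.X) :
    CechPic.pullback (A.X ◁ (y₁ * y₂)).left (detClass (HasRank.isFiniteLocallyFree' h1)) =
      CechPic.pullback (A.X ◁ y₁).left (detClass (HasRank.isFiniteLocallyFree' h1)) *
        CechPic.pullback (A.X ◁ y₂).left (detClass (HasRank.isFiniteLocallyFree' h1)) := by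
  classical
  obtain ⟨eσ⟩ := hsock
  -- the affine flat surjective cover `r : T″ → T` on which both `yᵢ` lift through `π`
  set q₁ : pullback y₁.left π.left ⟶ T.left := pullback.fst y₁.left π.left with hq₁
  set q₂ : pullback y₂.left π.left ⟶ T.left := pullback.fst y₂.left π.left with hq₂
  set b₁ : pullback y₁.left π.left ⟶ A.X.left := pullback.snd y₁.left π.left with hb₁
  set b₂ : pullback y₂.left π.left ⟶ A.X.left := pullback.snd y₂.left π.left with hb₂
  have hsq₁ : q₁ ≫ y₁.left = b₁ ≫ π.left := pullback.condition
  have hsq₂ : q₂ ≫ y₂.left = b₂ ≫ π.left := pullback.condition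
  set r : pullback q₁ q₂ ⟶ T.left := pullback.fst q₁ q₂ ≫ q₁ with hr
  have hr' : r = pullback.snd q₁ q₂ ≫ q₂ := pullback.condition
  haveI : Flat r := inferInstance
  haveI : Surjective r := inferInstance
  haveI : IsAffineHom q₁ := MorphismProperty.pullback_fst _ _ inferInstance
  haveI : IsAffineHom q₂ := MorphismProperty.pullback_fst _ _ inferInstance
  haveI : IsAffineHom (pullback.fst q₁ q₂) := MorphismProperty.pullback_fst _ _ inferInstance
  haveI : IsAffineHom r := inferInstance
  let T'' : Over S := Over.mk (r ≫ T.hom)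
  let rO : T'' ⟶ T := Over.homMk r rfl
  have hA : A.X.hom = π.left ≫ hat.X.hom := (Over.w π).symm
  have w₁ : (pullback.fst q₁ q₂ ≫ b₁) ≫ A.X.hom = r ≫ T.hom := by
    rw [hA, Category.assoc, ← Category.assoc b₁, ← hsq₁, Category.assoc, Over.w y₁, hr, Category.assoc]
  have w₂ : (pullback.snd q₁ q₂ ≫ b₂) ≫ A.X.hom = r ≫ T.hom := by
    rw [hA, Category.assoc, ← Category.assoc b₂, ← hsq₂, Category.assoc, Over.w y₂, hr', Category.assoc]
  let a₁ : T'' ⟶ A.X := Over.homMk (pullback.fst q₁ q₂ ≫ b₁) w₁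
  let a₂ : T'' ⟶ A.X := Over.homMk (pullback.snd q₁ q₂ ≫ b₂) w₂
  have ha₁ : a₁ ≫ π = rO ≫ y₁ := Over.OverMorphism.ext (by
    change (pullback.fst q₁ q₂ ≫ b₁) ≫ π.left = r ≫ y₁.left
    rw [Category.assoc, ← hsq₁, hr, Category.assoc])
  have ha₂ : a₂ ≫ π = rO ≫ y₂ := Over.OverMorphism.ext (by
    change (pullback.snd q₁ q₂ ≫ b₂) ≫ π.left = r ≫ y₂.left
    rw [Category.assoc, ← hsq₂, hr', Category.assoc])
  -- classes: `[(1 × π)^*𝒫] = [Λ(L)]`, and `(1 × r)^*[(1 × y)^*𝒫] = (1 × a)^*[Λ(L)]` whenever `a ≫ π = r ≫ y`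
  have h1f := HasRank.isFiniteLocallyFree' h1
  have hπP : CechPic.pullback (A.X ◁ π).left (detClass (HasRank.isFiniteLocallyFree' h1)) =
      A.mumfordClass (detClass (HasRank.isFiniteLocallyFree' hL)) := by
    rw [← detClass_pullback (A.X ◁ π).left (HasRank.isFiniteLocallyFree' h1),
      detClass_eq_of_iso eσ _ (HasRank.isFiniteLocallyFree' (A.hasRank_mumfordBundle hL)), A.detClass_mumfordBundle hL]
  have up : ∀ (y : T ⟶ hat.X) (a : T'' ⟶ A.X), a ≫ π = rO ≫ y →
      CechPic.pullback (A.X ◁ rO).left (CechPic.pullback (A.X ◁ y).left (detClass (HasRank.isFiniteLocallyFree' h1))) =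
        CechPic.pullback (A.X ◁ a).left (A.mumfordClass (detClass (HasRank.isFiniteLocallyFree' hL))) := by
    intro y a ha
    rw [← CechPic.pullback_comp, ← Over.comp_left, ← MonoidalCategory.whiskerLeft_comp, ← ha, MonoidalCategory.whiskerLeft_comp,
      Over.comp_left, CechPic.pullback_comp, hπP]
  have ha₁₂ : (a₁ * a₂) ≫ π = rO ≫ (y₁ * y₂) := by
    rw [MonObj.mul_comp, ha₁, ha₂, ← MonObj.comp_mul]
  have hup : CechPic.pullback (A.X ◁ rO).left
        (CechPic.pullback (A.X ◁ (y₁ * y₂)).left (detClass (HasRank.isFiniteLocallyFree' h1))) =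
      CechPic.pullback (A.X ◁ rO).left
        (CechPic.pullback (A.X ◁ y₁).left (detClass (HasRank.isFiniteLocallyFree' h1)) *
          CechPic.pullback (A.X ◁ y₂).left (detClass (HasRank.isFiniteLocallyFree' h1))) := by
    rw [map_mul, up _ _ ha₁₂, up _ _ ha₁, up _ _ ha₂]
    exact A.cechPic_pullback_whiskerLeft_mul_mumfordClass_of_isLocallyNoetherian _ hε a₁ a₂
  -- the two rigidified line bundles `(1 × (y₁y₂))^*𝒫` and `(1 × y₁)^*𝒫 ⊗ (1 × y₂)^*𝒫` on `A_T`
  have hM₁ : HasRank ((Scheme.Modules.pullback (A.X ◁ (y₁ * y₂)).left).obj P) 1 := hasRank_pullback _ h1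
  have hN₁ : HasRank ((Scheme.Modules.pullback (A.X ◁ y₁).left).obj P) 1 := hasRank_pullback _ h1
  have hN₂ : HasRank ((Scheme.Modules.pullback (A.X ◁ y₂).left).obj P) 1 := hasRank_pullback _ h1
  have hM₂ : HasRank (tensorObj ((Scheme.Modules.pullback (A.X ◁ y₁).left).obj P)
      ((Scheme.Modules.pullback (A.X ◁ y₂).left).obj P)) 1 := hasRank_tensorObj_one hN₁ hN₂
  have hM₁f := HasRank.isFiniteLocallyFree' hM₁
  have hN₁f := HasRank.isFiniteLocallyFree' hN₁
  have hN₂f := HasRank.isFiniteLocallyFree' hN₂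
  have hM₂f := HasRank.isFiniteLocallyFree' hM₂
  have hcl₁ : detClass hM₁f = CechPic.pullback (A.X ◁ (y₁ * y₂)).left (detClass (HasRank.isFiniteLocallyFree' h1)) :=
    (detClass_congr hM₁f (h1f.pullback _)).trans (detClass_pullback _ h1f)
  have hclN₁ : detClass hN₁f = CechPic.pullback (A.X ◁ y₁).left (detClass (HasRank.isFiniteLocallyFree' h1)) :=
    (detClass_congr hN₁f (h1f.pullback _)).trans (detClass_pullback _ h1f)
  have hclN₂ : detClass hN₂f = CechPic.pullback (A.X ◁ y₂).left (detClass (HasRank.isFiniteLocallyFree' h1)) :=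
    (detClass_congr hN₂f (h1f.pullback _)).trans (detClass_pullback _ h1f)
  have hcl₂ : detClass hM₂f = CechPic.pullback (A.X ◁ y₁).left (detClass (HasRank.isFiniteLocallyFree' h1)) *
      CechPic.pullback (A.X ◁ y₂).left (detClass (HasRank.isFiniteLocallyFree' h1)) := by
    rw [detClass_tensorObj_of_hasRank_one hN₁ hN₂ hN₁f hN₂f hM₂f, hclN₁, hclN₂]
  have rig₁ : Nonempty ((Scheme.Modules.pullback ((A.baseChange T.hom).unitSection : T.left ⟶ (A.X ⊗ T).left)).obj
      ((Scheme.Modules.pullback (A.X ◁ (y₁ * y₂)).left).obj P) ≅ SheafOfModules.unit _) :=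
    nonempty_iso_unitModule_of_detClass_eq_one (hasRank_pullback _ hM₁) (hM₁f.pullback _) (by
      rw [detClass_pullback ((A.baseChange T.hom).unitSection : T.left ⟶ (A.X ⊗ T).left) hM₁f, hcl₁]
      exact A.cechPic_pullback_unitSection_whiskerLeft_poincareClass hat P h1 hrig (y₁ * y₂))
  have rig₂ : Nonempty ((Scheme.Modules.pullback ((A.baseChange T.hom).unitSection : T.left ⟶ (A.X ⊗ T).left)).obj
      (tensorObj ((Scheme.Modules.pullback (A.X ◁ y₁).left).obj P) ((Scheme.Modules.pullback (A.X ◁ y₂).left).obj P)) ≅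
        SheafOfModules.unit _) :=
    nonempty_iso_unitModule_of_detClass_eq_one (hasRank_pullback _ hM₂) (hM₂f.pullback _) (by
      rw [detClass_pullback ((A.baseChange T.hom).unitSection : T.left ⟶ (A.X ⊗ T).left) hM₂f, hcl₂, map_mul]
      have e₁ := A.cechPic_pullback_unitSection_whiskerLeft_poincareClass hat P h1 hrig y₁
      have e₂ := A.cechPic_pullback_unitSection_whiskerLeft_poincareClass hat P h1 hrig y₂
      rw [e₁, e₂, mul_one])
  let M₁ : A.RigidifiedLineBundle T.hom := ⟨(Scheme.Modules.pullback (A.X ◁ (y₁ * y₂)).left).obj P, hM₁, rig₁⟩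
  let M₂ : A.RigidifiedLineBundle T.hom :=
    ⟨tensorObj ((Scheme.Modules.pullback (A.X ◁ y₁).left).obj P) ((Scheme.Modules.pullback (A.X ◁ y₂).left).obj P), hM₂, rig₂⟩
  -- they become isomorphic on `A_{T″}`: compare classes there (`1_A × r = A ◁ rO`)
  have hpm : A.prodMap (r ≫ T.hom) T.hom r rfl = (A.X ◁ rO).left := A.prodMap_eq_whiskerLeft_left r
  have hiso' : Nonempty ((Scheme.Modules.pullback (A.X ◁ rO).left).obj M₁.L ≅ (Scheme.Modules.pullback (A.X ◁ rO).left).obj M₂.L) := by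
    refine (nonempty_iso_iff_detClass_eq (hasRank_pullback _ hM₁) (hasRank_pullback _ hM₂)
      (hM₁f.pullback (A.X ◁ rO).left) (hM₂f.pullback (A.X ◁ rO).left)).2 ?_
    rw [detClass_pullback _ hM₁f, detClass_pullback _ hM₂f, hcl₁, hcl₂]
    exact hup
  obtain ⟨φ'⟩ := hiso'
  have hiso : Nonempty ((Scheme.Modules.pullback (A.prodMap (r ≫ T.hom) T.hom r rfl)).obj M₁.L ≅
      (Scheme.Modules.pullback (A.prodMap (r ≫ T.hom) T.hom r rfl)).obj M₂.L) :=
    ⟨eqToIso (congrArg (fun k => (Scheme.Modules.pullback k).obj M₁.L) hpm) ≪≫ φ' ≪≫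
      eqToIso (congrArg (fun k => (Scheme.Modules.pullback k).obj M₂.L) hpm.symm)⟩
  obtain ⟨e⟩ := RigidifiedLineBundle.nonempty_iso_of_pullback_prodMap_of_isLocallyNoetherian T.hom r M₁ M₂ hiso
  -- read the isomorphism on `A_T` back on classes
  have key := detClass_eq_of_iso e hM₁f hM₂f
  rw [hcl₁, hcl₂] at key
  exact key

end Square

end AbelianSchemeOver

end Literature.AlgebraicGeometry.AbelianSchemes

end
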